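import Mathlib.Combinatorics.SimpleGraph.Basic
import Mathlib.Logic.Relation
import Mathlib.Data.Fintype.Pi
import Mathlib.Data.Fintype.Sigma
import Mathlib.Algebra.BigOperators.Group.Finset.Basic
import Mathlib.Data.Fintype.BigOperators
import Mathlib.Algebra.Order.BigOperators.Group.Finset
import HarnessLib
import HarnessLib.Audit

/-!
# `NoHeavyLowerTail` (crux stmt-CriticalPhenomena-4575), Lemma B for graph clutters: KEMPE CHAINS of improper
# 3-colourings and the KEMPE PAIR LEMMA

Support file (seat `prim-l12-p2` gen 39; `--supports stmt-CriticalPhenomena-4575`).  No `sorry`; nothing is asserted about the crux.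
Memo: run/shared/lean/prim/prim-l12/prim-l12-p2/FINDING-g39b-KEMPE-IDENTITY-AND-LINKED-CONJECTURE.md (§1–§2).

SETTING.  `G` a finite simple graph, `σ : V → Fin 3` an ARBITRARY (improper) colouring.  For two colours `a, b` the
`(a,b)`-Kempe graph is `G` induced on `σ⁻¹{a,b}`; `KReach G σ a b q v` says that `v` lies in the `(a,b)`-chain of `q`
(reflexive–transitive closure of `KStep` = "adjacent, both coloured `a` or `b`"); `kflip G σ a b q` swaps `a ↔ b` on that chain.
FACTS (§1 of the memo): the flip does not change which edges are monochromatic (`kflip_mono_iff`), does not change the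
`(a,b)`-chains (`KReach_kflip_iff`) and is an involution (`kflip_kflip`).

THE KEMPE PAIR LEMMA.  Fix two edges `x = x₁x₂`, `y = y₁y₂` and any class `P` of colourings that is determined by the set of
monochromatic edges (`MonoDetermined`; e.g. "the monochromatic edges are exactly `M₀`").  Among the colourings of `P` in which
`x` and `y` are monochromatic, `σ ↦ (flip of the (σ x, σ y)-chain of y, old colour of y)` is a BIJECTION from those with
`σ x ≠ σ y` and `x, y` in DIFFERENT chains ("Kempe-separable", `sepSet`) onto the pairs `(ρ, j)` with `ρ x = ρ y`, `j ≠ ρ x`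
and `x, y` `(ρ x, j)`-separable (`sepTarget`): `kempe_pair_card_eq`.  Hence (`card_sepTarget_le`, `kempe_pair_card_le`)
`#separable ≤ 2 · #{σ x = σ y}` — exactly `Σ_ρ s(ρ)` with `s(ρ) = 2 − ℓ₌(ρ) ∈ {0,1,2}` the number of separable directions.
Summed over the colourings whose monochromatic set is a fixed 2- or 3-matching this is the KEMPE IDENTITY of the memo (§3),
`Q(G) = 2|A*| + Σ w·(ℓ₌ − ℓ≠)`: Lemma B for graph clutters is EQUIVALENT to the linked inequality `Λ ≤ 2|A*| + L₌` about pairs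
of monochromatic edges joined by a two-coloured path (memo §4; census-clean for all 13 702 graphs on ≤ 8 vertices, min ratio
31/30 at K₅ in the sharper form `Λ ≤ p`).  The normal form of `Q` needed to state that identity in the tree is not in this file.
-/

namespace Summit.CriticalPhenomena.PercolationContinuityZ3.Theorems.SunflowerPartition.Kempe

open Finset

open scoped Classical

variable {V : Type*} (G : SimpleGraph V)

/-! ## Swapping two colours -/

/-- Swap the colours `a` and `b` (identity on the other colours; identity if `a = b`). [this work] -/
def cswap (a b c : Fin 3) : Fin 3 := if c = a then b else if c = b then a else c

/-- `cswap` is an involution. [this work] -/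
theorem cswap_cswap (a b c : Fin 3) : cswap a b (cswap a b c) = c := by
  unfold cswap; split_ifs <;> simp_all

/-- `cswap` preserves membership in `{a, b}`. [this work] -/
theorem cswap_mem_iff (a b c : Fin 3) : (cswap a b c = a ∨ cswap a b c = b) ↔ (c = a ∨ c = b) := by
  unfold cswap; split_ifs <;> simp_all

/-- Outside `{a, b}`, `cswap` is the identity. [this work] -/
theorem cswap_of_not {a b c : Fin 3} (h : ¬(c = a ∨ c = b)) : cswap a b c = c := by
  unfold cswap; split_ifs <;> simp_all

/-- `cswap` is injective. [this work] -/
theorem cswap_inj {a b c d : Fin 3} (h : cswap a b c = cswap a b d) : c = d := by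
  have := congrArg (cswap a b) h
  rwa [cswap_cswap, cswap_cswap] at this

/-! ## Kempe chains -/

/-- One step inside the `(a,b)`-Kempe graph of `σ`: an edge of `G` whose two ends are coloured `a` or `b`. [this work] -/
def KStep (σ : V → Fin 3) (a b : Fin 3) (u v : V) : Prop :=
  G.Adj u v ∧ (σ u = a ∨ σ u = b) ∧ (σ v = a ∨ σ v = b)

/-- `KReach G σ a b q v`: `v` lies in the `(a,b)`-Kempe chain of `q` (reflexive–transitive closure of `KStep`). [this work] -/
def KReach (σ : V → Fin 3) (a b : Fin 3) : V → V → Prop :=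
  Relation.ReflTransGen (KStep G σ a b)

/-- A vertex of the chain of `q` other than `q` itself is coloured `a` or `b`. [this work] -/
theorem KReach.eq_or_mem {σ : V → Fin 3} {a b : Fin 3} {q v : V} (h : KReach G σ a b q v) :
    v = q ∨ (σ v = a ∨ σ v = b) := by
  unfold KReach at h
  rcases Relation.ReflTransGen.cases_tail h with rfl | ⟨w, _, hst⟩
  · exact Or.inl rfl
  · exact Or.inr hst.2.2

/-- If `q` is coloured `a` or `b`, so is its whole chain. [this work] -/
theorem KReach.mem {σ : V → Fin 3} {a b : Fin 3} {q v : V} (h : KReach G σ a b q v)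
    (hq : σ q = a ∨ σ q = b) : σ v = a ∨ σ v = b := by
  rcases h.eq_or_mem with rfl | h'
  · exact hq
  · exact h'

/-- The chain is closed under Kempe steps. [this work] -/
theorem KReach.step {σ : V → Fin 3} {a b : Fin 3} {q u v : V} (h : KReach G σ a b q u)
    (huv : G.Adj u v) (hu : σ u = a ∨ σ u = b) (hv : σ v = a ∨ σ v = b) : KReach G σ a b q v :=
  Relation.ReflTransGen.tail h ⟨huv, hu, hv⟩

/-! ## The flip of a chain -/

/-- Flip `a ↔ b` on the `(a,b)`-chain of `q`. [this work] -/
noncomputable def kflip (σ : V → Fin 3) (a b : Fin 3) (q : V) : V → Fin 3 :=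
  fun v => if KReach G σ a b q v then cswap a b (σ v) else σ v

/-- On the chain the flip swaps. [this work] -/
theorem kflip_of_reach {σ : V → Fin 3} {a b : Fin 3} {q v : V} (h : KReach G σ a b q v) :
    kflip G σ a b q v = cswap a b (σ v) := by
  unfold kflip; rw [if_pos h]

/-- Off the chain the flip does nothing. [this work] -/
theorem kflip_of_not_reach {σ : V → Fin 3} {a b : Fin 3} {q v : V} (h : ¬KReach G σ a b q v) :
    kflip G σ a b q v = σ v := by
  unfold kflip; rw [if_neg h]

/-- A vertex not coloured `a` or `b` keeps its colour. [this work] -/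
theorem kflip_of_not_mem {σ : V → Fin 3} {a b : Fin 3} {q v : V} (h : ¬(σ v = a ∨ σ v = b)) :
    kflip G σ a b q v = σ v := by
  unfold kflip; split_ifs
  · exact cswap_of_not h
  · rfl

/-- The flip preserves membership of every colour in `{a,b}`. [this work] -/
theorem kflip_mem_iff (σ : V → Fin 3) (a b : Fin 3) (q v : V) :
    (kflip G σ a b q v = a ∨ kflip G σ a b q v = b) ↔ (σ v = a ∨ σ v = b) := by
  unfold kflip; split_ifs
  · exact cswap_mem_iff a b (σ v)
  · exact Iff.rfl

/-- The flip does not change the Kempe steps. [this work] -/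
theorem KStep_kflip (σ : V → Fin 3) (a b : Fin 3) (q : V) :
    KStep G (kflip G σ a b q) a b = KStep G σ a b := by
  funext u v
  simp only [KStep, kflip_mem_iff]

/-- The flip does not change the `(a,b)`-chains. [this work] -/
theorem KReach_kflip_iff (σ : V → Fin 3) (a b : Fin 3) (q u v : V) :
    KReach G (kflip G σ a b q) a b u v ↔ KReach G σ a b u v := by
  unfold KReach; rw [KStep_kflip]

/-- The flip is an involution. [this work] -/
theorem kflip_kflip (σ : V → Fin 3) (a b : Fin 3) (q : V) :
    kflip G (kflip G σ a b q) a b q = σ := by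
  funext v
  by_cases h : KReach G σ a b q v
  · have h' : KReach G (kflip G σ a b q) a b q v := (KReach_kflip_iff G σ a b q q v).2 h
    rw [kflip_of_reach G h', kflip_of_reach G h, cswap_cswap]
  · have h' : ¬KReach G (kflip G σ a b q) a b q v := fun h'' => h ((KReach_kflip_iff G σ a b q q v).1 h'')
    rw [kflip_of_not_reach G h', kflip_of_not_reach G h]

/-- KEY FACT: a Kempe flip does not change which edges are monochromatic. [this work] -/
theorem kflip_mono_iff (σ : V → Fin 3) (a b : Fin 3) (q : V) {u v : V} (huv : G.Adj u v) :
    kflip G σ a b q u = kflip G σ a b q v ↔ σ u = σ v := by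
  by_cases hu : σ u = a ∨ σ u = b
  · by_cases hv : σ v = a ∨ σ v = b
    · -- both ends in `{a,b}`: they are in the chain together or not at all
      by_cases ru : KReach G σ a b q u
      · have rv : KReach G σ a b q v := ru.step G huv hu hv
        rw [kflip_of_reach G ru, kflip_of_reach G rv]
        exact ⟨cswap_inj, fun h => by rw [h]⟩
      · have rv : ¬KReach G σ a b q v := fun rv => ru (rv.step G huv.symm hv hu)
        rw [kflip_of_not_reach G ru, kflip_of_not_reach G rv]
    · -- `u` in `{a,b}`, `v` not: different before and after
      rw [kflip_of_not_mem G hv]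
      have h1 : σ u ≠ σ v := fun h => hv (h ▸ hu)
      have h2 : kflip G σ a b q u ≠ σ v := by
        intro h
        have := (kflip_mem_iff G σ a b q u).2 hu
        rw [h] at this
        exact hv this
      exact ⟨fun h => (h2 h).elim, fun h => (h1 h).elim⟩
  · rw [kflip_of_not_mem G hu]
    by_cases hv : σ v = a ∨ σ v = b
    · have h1 : σ u ≠ σ v := fun h => hu (h ▸ hv)
      have h2 : σ u ≠ kflip G σ a b q v := by
        intro h
        have := (kflip_mem_iff G σ a b q v).2 hv
        rw [← h] at this
        exact hu this
      exact ⟨fun h => (h2 h).elim, fun h => (h1 h).elim⟩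
    · rw [kflip_of_not_mem G hv]

/-! ## The Kempe pair lemma -/

/-- A class of colourings is MONO-DETERMINED if it only depends on which edges are monochromatic. [this work] -/
def MonoDetermined (P : (V → Fin 3) → Prop) : Prop :=
  ∀ σ τ : V → Fin 3, (∀ u v, G.Adj u v → (σ u = σ v ↔ τ u = τ v)) → P σ → P τ

/-- A Kempe flip stays inside every mono-determined class. [this work] -/
theorem MonoDetermined.kflip {P : (V → Fin 3) → Prop} (hP : MonoDetermined G P) {σ : V → Fin 3}
    (hσ : P σ) (a b : Fin 3) (q : V) : P (kflip G σ a b q) :=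
  hP σ _ (fun _ _ huv => (kflip_mono_iff G σ a b q huv).symm) hσ

section PairLemma

variable [Fintype V] [DecidableEq V]

/-- The colourings of `P` in which the edges `x₁x₂`, `y₁y₂` are monochromatic of DIFFERENT colours and Kempe-SEPARABLE
(`x₁` is not in the `(σ x₁, σ y₁)`-chain of `y₁`). [this work] -/
noncomputable def sepSet (P : (V → Fin 3) → Prop) (x₁ x₂ y₁ y₂ : V) : Finset (V → Fin 3) :=
  univ.filter fun σ => P σ ∧ σ x₁ = σ x₂ ∧ σ y₁ = σ y₂ ∧ σ x₁ ≠ σ y₁ ∧ ¬KReach G σ (σ x₁) (σ y₁) y₁ x₁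

/-- The colourings of `P` in which `x₁x₂`, `y₁y₂` are monochromatic of the SAME colour. [this work] -/
noncomputable def eqSet (P : (V → Fin 3) → Prop) (x₁ x₂ y₁ y₂ : V) : Finset (V → Fin 3) :=
  univ.filter fun σ => P σ ∧ σ x₁ = σ x₂ ∧ σ y₁ = σ y₂ ∧ σ x₁ = σ y₁

/-- There are exactly two colours different from a given one. [this work] -/
theorem card_ne_colour (c : Fin 3) : (univ.filter fun b : Fin 3 => b ≠ c).card = 2 := by
  rw [Finset.filter_ne' univ c, Finset.card_erase_of_mem (mem_univ c)]
  simp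

/-- **KEMPE PAIR LEMMA** (inequality form).  In a mono-determined class, the Kempe-separable colourings with `x, y`
monochromatic of different colours number at most twice the colourings with `x, y` monochromatic of the same colour:
`σ ↦ (flip of the chain of y, old colour of y)` is injective. [this work] -/
theorem kempe_pair_card_le {P : (V → Fin 3) → Prop} (hP : MonoDetermined G P) {x₁ x₂ y₁ y₂ : V}
    (hx : G.Adj x₁ x₂) (hy : G.Adj y₁ y₂) :
    (sepSet G P x₁ x₂ y₁ y₂).card ≤ 2 * (eqSet P x₁ x₂ y₁ y₂).card := by
  -- target: pairs (ρ, b) with ρ in `eqSet` and `b ≠ ρ x₁`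
  set T : Finset (Σ _ : V → Fin 3, Fin 3) :=
    (eqSet P x₁ x₂ y₁ y₂).sigma fun ρ => univ.filter fun b : Fin 3 => b ≠ ρ x₁ with hT
  have hTcard : T.card = 2 * (eqSet P x₁ x₂ y₁ y₂).card := by
    rw [hT, Finset.card_sigma]
    simp_rw [card_ne_colour]
    rw [Finset.sum_const, smul_eq_mul, mul_comm]
  rw [← hTcard]
  -- the map
  let Φ : (V → Fin 3) → (Σ _ : V → Fin 3, Fin 3) := fun σ => ⟨kflip G σ (σ x₁) (σ y₁) y₁, σ y₁⟩
  refine Finset.card_le_card_of_injOn Φ (fun σ hσ => ?_) (fun σ hσ τ hτ hΦ => ?_)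
  · -- Φ maps `sepSet` into `T`
    simp only [sepSet, Finset.mem_coe, Finset.mem_filter, Finset.mem_univ, true_and] at hσ
    obtain ⟨hPσ, hxx, hyy, hne, hsep⟩ := hσ
    set a := σ x₁ with ha
    set b := σ y₁ with hb
    -- `x₁, x₂` are off the chain of `y₁`; `y₁, y₂` are on it
    have rx₁ : ¬KReach G σ a b y₁ x₁ := hsep
    have rx₂ : ¬KReach G σ a b y₁ x₂ := fun h =>
      rx₁ (h.step G hx.symm (Or.inl hxx.symm) (Or.inl rfl))
    have ry₁ : KReach G σ a b y₁ y₁ := Relation.ReflTransGen.refl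
    have ry₂ : KReach G σ a b y₁ y₂ := ry₁.step G hy (Or.inr rfl) (Or.inr hyy.symm)
    have e1 : kflip G σ a b y₁ x₁ = a := by rw [kflip_of_not_reach G rx₁]
    have e2 : kflip G σ a b y₁ x₂ = a := by rw [kflip_of_not_reach G rx₂]; exact hxx.symm
    have e3 : kflip G σ a b y₁ y₁ = a := by
      rw [kflip_of_reach G ry₁]; unfold cswap; rw [if_neg (Ne.symm hne), if_pos rfl]
    have e4 : kflip G σ a b y₁ y₂ = a := by
      rw [kflip_of_reach G ry₂, ← hyy]; unfold cswap; rw [if_neg (Ne.symm hne), if_pos rfl]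
    simp only [hT, Finset.mem_coe, Finset.mem_sigma, eqSet, Finset.mem_filter, Finset.mem_univ, true_and, Φ]
    refine ⟨⟨hP.kflip G hPσ a b y₁, ?_, ?_, ?_⟩, ?_⟩
    · rw [e1, e2]
    · rw [e3, e4]
    · rw [e1, e3]
    · rw [e1]; exact Ne.symm hne
  · -- Φ is injective on `sepSet`: flip back
    simp only [Φ, Sigma.mk.injEq] at hΦ
    obtain ⟨hflip, hcol⟩ := hΦ
    simp only [sepSet, Finset.mem_coe, Finset.mem_filter, Finset.mem_univ, true_and] at hσ hτ
    have hsepσ := hσ.2.2.2.2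
    have hsepτ := hτ.2.2.2.2
    -- both `σ x₁` and `τ x₁` are read off the flipped colouring at `x₁`
    have hx₁σ : kflip G σ (σ x₁) (σ y₁) y₁ x₁ = σ x₁ := kflip_of_not_reach G hsepσ
    have hx₁τ : kflip G τ (τ x₁) (τ y₁) y₁ x₁ = τ x₁ := kflip_of_not_reach G hsepτ
    have hax : σ x₁ = τ x₁ := by rw [← hx₁σ, ← hx₁τ, hflip]
    have hcol' : σ y₁ = τ y₁ := eq_of_heq hcol
    calc σ = kflip G (kflip G σ (σ x₁) (σ y₁) y₁) (σ x₁) (σ y₁) y₁ := (kflip_kflip G σ _ _ y₁).symm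
      _ = kflip G (kflip G τ (τ x₁) (τ y₁) y₁) (τ x₁) (τ y₁) y₁ := by rw [hflip, hax, hcol']
      _ = τ := kflip_kflip G τ _ _ y₁

/-- The exact target of the flip map: pairs `(ρ, j)` with `ρ ∈ eqSet`, `j ≠ ρ x₁` and `x, y` `(ρ x₁, j)`-separable in `ρ`.
Its cardinality is `Σ_{ρ ∈ eqSet} s(ρ)` with `s(ρ) = #{j ≠ c : x, y (c,j)-separable} = 2 − ℓ₌(ρ)` (memo §2). [this work] -/
noncomputable def sepTarget (P : (V → Fin 3) → Prop) (x₁ x₂ y₁ y₂ : V) : Finset (Σ _ : V → Fin 3, Fin 3) :=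
  (eqSet P x₁ x₂ y₁ y₂).sigma fun ρ => univ.filter fun j : Fin 3 => j ≠ ρ x₁ ∧ ¬KReach G ρ (ρ x₁) j y₁ x₁

/-- **KEMPE PAIR LEMMA** (exact form): `σ ↦ (flip of the chain of y, old colour of y)` is a BIJECTION from the Kempe-separable
colourings with `x, y` monochromatic of different colours onto `sepTarget` — so their number is `Σ_{ρ : σ x = σ y} s(ρ)`,
`s(ρ)` = the number of colours `j ≠ ρ x` for which `x, y` are `(ρ x, j)`-separable. [this work] -/
theorem kempe_pair_card_eq {P : (V → Fin 3) → Prop} (hP : MonoDetermined G P) {x₁ x₂ y₁ y₂ : V}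
    (hx : G.Adj x₁ x₂) (hy : G.Adj y₁ y₂) :
    (sepSet G P x₁ x₂ y₁ y₂).card = (sepTarget G P x₁ x₂ y₁ y₂).card := by
  refine Finset.card_bij' (fun σ _ => ⟨kflip G σ (σ x₁) (σ y₁) y₁, σ y₁⟩)
    (fun τ _ => kflip G τ.1 (τ.1 x₁) τ.2 y₁) (fun σ hσ => ?_) (fun τ hτ => ?_) (fun σ hσ => ?_) (fun τ hτ => ?_)
  · -- into the target
    simp only [sepSet, Finset.mem_filter, Finset.mem_univ, true_and] at hσ
    obtain ⟨hPσ, hxx, hyy, hne, hsep⟩ := hσ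
    set a := σ x₁ with ha
    set b := σ y₁ with hb
    have rx₁ : ¬KReach G σ a b y₁ x₁ := hsep
    have rx₂ : ¬KReach G σ a b y₁ x₂ := fun h =>
      rx₁ (h.step G hx.symm (Or.inl hxx.symm) (Or.inl rfl))
    have ry₁ : KReach G σ a b y₁ y₁ := Relation.ReflTransGen.refl
    have ry₂ : KReach G σ a b y₁ y₂ := ry₁.step G hy (Or.inr rfl) (Or.inr hyy.symm)
    have e1 : kflip G σ a b y₁ x₁ = a := by rw [kflip_of_not_reach G rx₁]
    have e2 : kflip G σ a b y₁ x₂ = a := by rw [kflip_of_not_reach G rx₂]; exact hxx.symm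
    have e3 : kflip G σ a b y₁ y₁ = a := by
      rw [kflip_of_reach G ry₁]; unfold cswap; rw [if_neg (Ne.symm hne), if_pos rfl]
    have e4 : kflip G σ a b y₁ y₂ = a := by
      rw [kflip_of_reach G ry₂, ← hyy]; unfold cswap; rw [if_neg (Ne.symm hne), if_pos rfl]
    simp only [sepTarget, Finset.mem_sigma, eqSet, Finset.mem_filter, Finset.mem_univ, true_and]
    refine ⟨⟨hP.kflip G hPσ a b y₁, ?_, ?_, ?_⟩, ?_, ?_⟩
    · rw [e1, e2]
    · rw [e3, e4]
    · rw [e1, e3]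
    · rw [e1]; exact Ne.symm hne
    · rw [e1, KReach_kflip_iff]; exact rx₁
  · -- the inverse lands in `sepSet`
    obtain ⟨ρ, j⟩ := τ
    simp only [sepTarget, Finset.mem_sigma, eqSet, Finset.mem_filter, Finset.mem_univ, true_and] at hτ
    obtain ⟨⟨hPρ, hxx, hyy, hxy⟩, hj, hsep⟩ := hτ
    set a := ρ x₁ with ha
    have rx₁ : ¬KReach G ρ a j y₁ x₁ := hsep
    have rx₂ : ¬KReach G ρ a j y₁ x₂ := fun h =>
      rx₁ (h.step G hx.symm (Or.inl hxx.symm) (Or.inl rfl))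
    have ry₁ : KReach G ρ a j y₁ y₁ := Relation.ReflTransGen.refl
    have ry₂ : KReach G ρ a j y₁ y₂ := ry₁.step G hy (Or.inl hxy.symm) (Or.inl (hyy ▸ hxy.symm))
    have e1 : kflip G ρ a j y₁ x₁ = a := by rw [kflip_of_not_reach G rx₁]
    have e2 : kflip G ρ a j y₁ x₂ = a := by rw [kflip_of_not_reach G rx₂]; exact hxx.symm
    have e3 : kflip G ρ a j y₁ y₁ = j := by
      rw [kflip_of_reach G ry₁, ← hxy]; unfold cswap; rw [if_pos rfl]
    have e4 : kflip G ρ a j y₁ y₂ = j := by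
      rw [kflip_of_reach G ry₂, ← hyy, ← hxy]; unfold cswap; rw [if_pos rfl]
    simp only [sepSet, Finset.mem_filter, Finset.mem_univ, true_and]
    refine ⟨hP.kflip G hPρ a j y₁, ?_, ?_, ?_, ?_⟩
    · rw [e1, e2]
    · rw [e3, e4]
    · rw [e1, e3]; exact Ne.symm hj
    · rw [e1, e3, KReach_kflip_iff]; exact rx₁
  · -- left inverse
    simp only [sepSet, Finset.mem_filter, Finset.mem_univ, true_and] at hσ
    have hsep := hσ.2.2.2.2
    have hx₁ : kflip G σ (σ x₁) (σ y₁) y₁ x₁ = σ x₁ := kflip_of_not_reach G hsep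
    simp only [hx₁]
    exact kflip_kflip G σ _ _ y₁
  · -- right inverse
    obtain ⟨ρ, j⟩ := τ
    simp only [sepTarget, Finset.mem_sigma, eqSet, Finset.mem_filter, Finset.mem_univ, true_and] at hτ
    obtain ⟨⟨_, _, _, hxy⟩, _, hsep⟩ := hτ
    have e1 : kflip G ρ (ρ x₁) j y₁ x₁ = ρ x₁ := kflip_of_not_reach G hsep
    have ry₁ : KReach G ρ (ρ x₁) j y₁ y₁ := Relation.ReflTransGen.refl
    have e3 : kflip G ρ (ρ x₁) j y₁ y₁ = j := by
      rw [kflip_of_reach G ry₁, ← hxy]; unfold cswap; rw [if_pos rfl]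
    simp only [e1, e3, kflip_kflip]

/-- `sepTarget ⊆` all pairs `(ρ, j)` with `j ≠ ρ x₁`, so the exact form implies the inequality form. [this work] -/
theorem card_sepTarget_le (P : (V → Fin 3) → Prop) (x₁ x₂ y₁ y₂ : V) :
    (sepTarget G P x₁ x₂ y₁ y₂).card ≤ 2 * (eqSet P x₁ x₂ y₁ y₂).card := by
  unfold sepTarget
  rw [Finset.card_sigma]
  calc ∑ ρ ∈ eqSet P x₁ x₂ y₁ y₂, (univ.filter fun j : Fin 3 => j ≠ ρ x₁ ∧ ¬KReach G ρ (ρ x₁) j y₁ x₁).card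
      ≤ ∑ ρ ∈ eqSet P x₁ x₂ y₁ y₂, 2 := by
        refine Finset.sum_le_sum fun ρ _ => ?_
        calc (univ.filter fun j : Fin 3 => j ≠ ρ x₁ ∧ ¬KReach G ρ (ρ x₁) j y₁ x₁).card
            ≤ (univ.filter fun j : Fin 3 => j ≠ ρ x₁).card :=
              Finset.card_le_card (Finset.monotone_filter_right _ fun j _ h => h.1)
          _ = 2 := card_ne_colour (ρ x₁)
    _ = 2 * (eqSet P x₁ x₂ y₁ y₂).card := by rw [Finset.sum_const, smul_eq_mul, mul_comm]

end PairLemma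


/-! ## The balance form used by the Kempe identity -/

section Balance

variable [Fintype V] [DecidableEq V]

/-- The colourings of `P` in which `x₁x₂`, `y₁y₂` are monochromatic of DIFFERENT colours and Kempe-LINKED (`x₁` lies in the
`(σ x₁, σ y₁)`-chain of `y₁`): the quantity `ℓ≠` of the memo, summed over the class. [this work] -/
noncomputable def linkSet (P : (V → Fin 3) → Prop) (x₁ x₂ y₁ y₂ : V) : Finset (V → Fin 3) :=
  univ.filter fun σ => P σ ∧ σ x₁ = σ x₂ ∧ σ y₁ = σ y₂ ∧ σ x₁ ≠ σ y₁ ∧ KReach G σ (σ x₁) (σ y₁) y₁ x₁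

/-- All colourings of `P` in which `x₁x₂`, `y₁y₂` are monochromatic of different colours. [this work] -/
noncomputable def neSet (P : (V → Fin 3) → Prop) (x₁ x₂ y₁ y₂ : V) : Finset (V → Fin 3) :=
  univ.filter fun σ => P σ ∧ σ x₁ = σ x₂ ∧ σ y₁ = σ y₂ ∧ σ x₁ ≠ σ y₁

/-- `#neSet = #sepSet + #linkSet` (separable / linked dichotomy). [this work] -/
theorem card_sepSet_add_card_linkSet (P : (V → Fin 3) → Prop) (x₁ x₂ y₁ y₂ : V) :
    (sepSet G P x₁ x₂ y₁ y₂).card + (linkSet G P x₁ x₂ y₁ y₂).card = (neSet P x₁ x₂ y₁ y₂).card := by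
  have h := Finset.card_filter_add_card_filter_not
    (s := neSet P x₁ x₂ y₁ y₂) (fun σ : V → Fin 3 => ¬KReach G σ (σ x₁) (σ y₁) y₁ x₁)
  have e1 : (neSet P x₁ x₂ y₁ y₂).filter (fun σ : V → Fin 3 => ¬KReach G σ (σ x₁) (σ y₁) y₁ x₁)
      = sepSet G P x₁ x₂ y₁ y₂ := by
    ext σ; simp only [neSet, sepSet, Finset.mem_filter, Finset.mem_univ, true_and]; tauto
  have e2 : (neSet P x₁ x₂ y₁ y₂).filter (fun σ : V → Fin 3 => ¬¬KReach G σ (σ x₁) (σ y₁) y₁ x₁)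
      = linkSet G P x₁ x₂ y₁ y₂ := by
    ext σ; simp only [neSet, linkSet, Finset.mem_filter, Finset.mem_univ, true_and, not_not, and_assoc]
  rw [e1, e2] at h
  exact h

/-- **KEMPE PAIR BALANCE**: in a mono-determined class, `#{σ x ≠ σ y} − #{linked} ≤ 2 · #{σ x = σ y}`, i.e.
`2·#{=} − #{≠} ≥ −ℓ≠`-mass — the form in which the pair lemma enters the Kempe identity `Q(G) = 2|A*| + Σ w·(ℓ₌ − ℓ≠)` and the
bound `Q(G) ≥ 2|A*| − Λ(G)` (memo §3–§4). [this work] -/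
theorem kempe_pair_balance {P : (V → Fin 3) → Prop} (hP : MonoDetermined G P) {x₁ x₂ y₁ y₂ : V}
    (hx : G.Adj x₁ x₂) (hy : G.Adj y₁ y₂) :
    (neSet P x₁ x₂ y₁ y₂).card ≤ 2 * (eqSet P x₁ x₂ y₁ y₂).card + (linkSet G P x₁ x₂ y₁ y₂).card := by
  have h1 := card_sepSet_add_card_linkSet G P x₁ x₂ y₁ y₂
  have h2 := kempe_pair_card_le G hP hx hy
  omega

end Balance

end Summit.CriticalPhenomena.PercolationContinuityZ3.Theorems.SunflowerPartition.Kempe
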